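import Mathlib
import Summits.Ventures.HodgeRepro.Tier4.Line1.RTFSetting
import Summits.Ventures.HodgeRepro.Tier4.Line1.RtfSpectralStep
import Summits.Ventures.HodgeRepro.Tier4.Line1.SpectralOfRTF
import Summits.Ventures.HodgeRepro.Tier4.Line1.SpectralOfRTFIsolated
import Summits.Ventures.HodgeRepro.Tier4.Line1.SpectralRegroup
import Summits.Ventures.HodgeRepro.Tier4.Line1.HeckeFiniteness

/-!
# Tier4/Line1/HeckeIsolation — (S3a), the RTF half of (S3″): an isolating test pair from the Hecke block algebra,
with the admissibility theory (C1)–(C3) DISPLAYED in rank-one form and the finite-dimensional step (D) PROVED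

Blind re-derivation cell `pub-hodge-repro`, Tier 4 (README §9–§10), seat t4-L1-p5 (prover, LINE L1, gen 3; self-pointed
cut S13690 on clause (6) of the L1 residual — t4-L1-p1 g3's anatomy note S13560 §2, piece (D)).  Paper note:
proofs/t4/L1/S3a-block-algebra-t4-L1-p5.md.  Target tree path `lean/Summits/Ventures/HodgeRepro/Tier4/Line1/HeckeIsolation.lean`.

WHAT THIS IS.  p1's (S3″) `IsolationRealised` (SpectralOfRTFIsolated p679928) asks that a constituent `τ m` carrying both
toric periods be ISOLATED by the test pair of some Hecke choice: every other block of the spectral expansion of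
`J(f₁ ⋆ f₂)` vanishes and the `m`-block does not (`IsolatedAt`).  Its RTF half (S3a) — «SOME test pair isolates
`τ m`» — is, on the generic `RTF.Setting G`, finite-dimensional algebra on one block ONCE the Hecke algebra is known
to act on the admissible block of `τ m` as its full endomorphism algebra and to kill every other constituent: that is
the admissibility theory (A)+(C1)+(C2)+(C3) the tree lacks (finiteness of the level set ✓ in the tree, simplicity of
`(τ m)^K` over `H(G,K)`, pairwise non-isomorphism, Jacobson density + Schur over ℂ).  This file DISPLAYS exactly that
consequence and PROVES the step (D) from it:
* `HeckeRankOne S τ m Vfin` — for every `v, w` in a displayed set `Vfin ⊆ τ m` of ADMISSIBLE vectors there is a test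
  function `f` with `R(f) = 0` on every `τ m'`, `m' ≠ m`, and `R(f) = ⟪·, v⟫ w` (the rank-one operator for the
  `L²(D_G)` pairing `S.inner`) on `τ m`.  On the intended instance this holds for `Vfin` = the `K_f`-fixed
  `K_∞`-finite vectors (idempotent `e = e_{K_f} ⋆ e_σ`, finite level set, Jacobson density: note §1) and FAILS for
  `Vfin = τ m` (a non-`K_∞`-finite `w` lies in no `R(f)`-image) — `Vfin` is displayed and load-bearing.
* `exists_isolatedAt_of_heckeRankOne` (THE THEOREM): `HeckeRankOne` + both toric periods non-zero ON `Vfin` ⟹ some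
  test pair `(f₁, f₂)` has `IsolatedAt … m`.  Proof: `f₁ := cj f` with `R(f) = ⟪·, w⟫ w`, `f₂ := refl f'` with
  `R(f') = ⟪·, w⟫ w'`; the other blocks vanish termwise; the `m`-block equals `ℓ'(w') · conj ℓ(w) · ⟪w, w⟫` by BLOCK
  PARSEVAL (`hasSum_block_inner_mul_inner`: the Hilbert basis of `L²(D_G)` built from `hB.orth` + `hB.complete`, as in
  p3's `kernel_spectral`, restricted to the fibre `n⁻¹{m}` through `hB.orthSub`), and is non-zero by p1's
  `inner_self_ne_zero_of_invariant`.
* `isolationRealised_of_heckeRankOne`: (S3″) itself from `HeckeRankOne` at every `m`, the two period clauses on the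
  admissible vectors (`PeriodAdmissible`, `PeriodAdmissible'`: «a toric period non-zero on `τ m` is non-zero on its
  admissible vectors» — the density of admissible vectors in a topology where the periods are continuous, plan-1's
  archimedean refinement; displayed, not derived) and the dictionary clause `Realised` ((S3b): an isolating test pair
  is the test pair of some Hecke choice — DATA, never typed).  The lift clause `Lift m` is not used: with the RTF half a
  theorem, the weight of the lift sits in (S1″).
Nothing of (C1)–(C3), of the density clause or of the dictionary is proved here: they are hypotheses of every theorem
that uses them, displayed by name; no instance of them is claimed.  Nothing here says anything about the status of the
Hodge conjecture for CM abelian varieties, which is NOT proved (HC_CM is NOT proved by anyone in this repository).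
-/

set_option autoImplicit false

noncomputable section

namespace Summit.Ventures.HodgeRepro.Tier4.Line1

open MeasureTheory Topology
open scoped InnerProductSpace

namespace RTF

variable {G : Type} [Group G] [TopologicalSpace G] [IsTopologicalGroup G] [MeasurableSpace G] [BorelSpace G]

omit [Group G] [TopologicalSpace G] [IsTopologicalGroup G] [MeasurableSpace G] [BorelSpace G] in
/-- conjugating a test function twice gives it back. -/
theorem cj_cj (f : G → ℂ) : cj (cj f) = f := by
  funext g
  simp [cj]

omit [TopologicalSpace G] [IsTopologicalGroup G] [MeasurableSpace G] [BorelSpace G] in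
/-- reflecting a test function twice gives it back. -/
theorem refl_refl (f : G → ℂ) : refl (refl f) = f := by
  funext g
  simp [refl]

namespace Setting

variable (S : Setting G)

section Parseval

omit [IsTopologicalGroup G] [BorelSpace G] in
/-- the `L²(D_G)` pairing is conjugate-symmetric: `conj ⟪a, b⟫ = ⟪b, a⟫`. -/
theorem conj_inner (a b : G → ℂ) : starRingEnd ℂ (S.inner a b) = S.inner b a := by
  unfold inner
  rw [← integral_conj]
  refine integral_congr_ae (Filter.Eventually.of_forall fun x => ?_)
  simp only [map_mul, Complex.conj_conj]
  ring

omit [IsTopologicalGroup G] in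
/-- **PARSEVAL in `L²(D_G, μ)`** for an adapted orthonormal family (orthonormal by `hB.orth`, complete by
`hB.complete`, hence a Hilbert basis of `L²(D_G)` — `HilbertBasis.mkOfOrthogonalEqBot`, as in p3's `kernel_spectral`):
for continuous `a`, `b`, `∑_j ⟪a, φ_j⟫ ⟪φ_j, b⟫ = ⟪a, b⟫` (`HilbertBasis.hasSum_inner_mul_inner`). -/
theorem hasSum_inner_mul_inner {τ : ℕ → Set (G → ℂ)} {φ : ℕ → G → ℂ} {n : ℕ → ℕ} (hB : S.IsAdaptedONB τ φ n)
    {a b : G → ℂ} (ha : Continuous a) (hb : Continuous b) :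
    HasSum (fun j => S.inner a (φ j) * S.inner (φ j) b) (S.inner a b) := by
  haveI := S.haar
  haveI := S.isFiniteMeasure_DG
  have hφc : ∀ j, Continuous (φ j) := fun j => (hB.inv (n j)).cont _ (hB.mem j)
  have hφL : ∀ j, MemLp (φ j) 2 (S.μ.restrict S.DG) := fun j => S.memLp_two_DG (hφc j)
  let v : ℕ → Lp ℂ 2 (S.μ.restrict S.DG) := fun j => (hφL j).toLp (φ j)
  have hv : Orthonormal ℂ v := by
    rw [orthonormal_iff_ite]
    intro i j
    show ⟪(hφL i).toLp (φ i), (hφL j).toLp (φ j)⟫_ℂ = _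
    rw [S.L2_inner_eq, hB.orth]
    by_cases hij : i = j
    · simp [hij]
    · simp [hij, Ne.symm hij]
  have hsp : (Submodule.span ℂ (Set.range v))ᗮ = ⊥ := by
    rw [Submodule.eq_bot_iff]
    intro ψ hψ
    rw [Submodule.mem_orthogonal] at hψ
    have hz : ∀ j, S.inner (ψ : G → ℂ) (φ j) = 0 := by
      intro j
      have h := hψ (v j) (Submodule.subset_span ⟨j, rfl⟩)
      rw [L2.inner_def] at h
      unfold Setting.inner
      rw [← h]
      apply integral_congr_ae
      filter_upwards [(hφL j).coeFn_toLp] with w hw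
      show _ = ⟪(v j) w, ψ w⟫_ℂ
      rw [hw, RCLike.inner_apply]
    exact Lp.eq_zero_iff_ae_eq_zero.mpr (hB.complete ψ (Lp.memLp ψ) hz)
  let bs : HilbertBasis ℕ ℂ (Lp ℂ 2 (S.μ.restrict S.DG)) := HilbertBasis.mkOfOrthogonalEqBot hv hsp
  have hbs : ∀ j, bs j = v j := fun j => by
    simp only [bs, HilbertBasis.coe_mkOfOrthogonalEqBot]
  have haL : MemLp a 2 (S.μ.restrict S.DG) := S.memLp_two_DG ha
  have hbL : MemLp b 2 (S.μ.restrict S.DG) := S.memLp_two_DG hb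
  have key := bs.hasSum_inner_mul_inner (hbL.toLp b) (haL.toLp a)
  have e1 : ∀ j, ⟪hbL.toLp b, bs j⟫_ℂ = S.inner (φ j) b := fun j => by
    rw [hbs]
    exact S.L2_inner_eq hbL (hφL j)
  have e2 : ∀ j, ⟪bs j, haL.toLp a⟫_ℂ = S.inner a (φ j) := fun j => by
    rw [hbs]
    exact S.L2_inner_eq (hφL j) haL
  have e3 : ⟪hbL.toLp b, haL.toLp a⟫_ℂ = S.inner a b := S.L2_inner_eq hbL haL
  simp only [e1, e2, e3] at key
  refine key.congr_fun ?_
  intro j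
  ring

omit [IsTopologicalGroup G] in
/-- **BLOCK PARSEVAL**: for `a ∈ τ m` and `b` continuous the Parseval sum runs over the `τ m`-block of the adapted
family alone, `∑_{j : n j = m} ⟪a, φ_j⟫ ⟪φ_j, b⟫ = ⟪a, b⟫` — the other terms vanish by the orthogonality of the
constituents (`hB.orthSub`). -/
theorem hasSum_block_inner_mul_inner {τ : ℕ → Set (G → ℂ)} {φ : ℕ → G → ℂ} {n : ℕ → ℕ}
    (hB : S.IsAdaptedONB τ φ n) {m : ℕ} {a b : G → ℂ} (ha : a ∈ τ m) (hb : Continuous b) :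
    HasSum (fun j : n ⁻¹' {m} => S.inner a (φ j) * S.inner (φ j) b) (S.inner a b) := by
  have hac : Continuous a := (hB.inv m).cont a ha
  have hfull := S.hasSum_inner_mul_inner hB hac hb
  have hsupp : Function.support (fun j => S.inner a (φ j) * S.inner (φ j) b) ⊆ n ⁻¹' {m} := by
    intro j hj
    by_contra hjm
    apply hj
    have hne : m ≠ n j := by
      intro h
      exact hjm (by simp [h])
    show S.inner a (φ j) * S.inner (φ j) b = 0
    rw [hB.orthSub m (n j) hne a ha (φ j) (hB.mem j), zero_mul]
  exact (hasSum_subtype_iff_of_support_subset hsupp).mpr hfull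

end Parseval

section Blocks

variable (χ : S.T → ℂ) (χ' : S.T' → ℂ) (φ : ℕ → G → ℂ) (n : ℕ → ℕ) (f₁ f₂ : G → ℂ)

omit [IsTopologicalGroup G] [BorelSpace G] in
/-- the `T'`-period of the zero function vanishes. -/
theorem periodT'_zero : S.periodT' χ' (fun _ => 0) = 0 := by
  unfold periodT'
  simp

omit [IsTopologicalGroup G] [BorelSpace G] in
/-- a block whose constituent is killed by `R(f̄₁)` vanishes. -/
theorem specBlock_eq_zero_of_R_eq_zero {τ : ℕ → Set (G → ℂ)} (hB : S.IsAdaptedONB τ φ n) {m' : ℕ}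
    (h : ∀ ψ ∈ τ m', S.R (cj f₁) ψ = fun _ => 0) : specBlock S χ χ' φ n f₁ f₂ m' = 0 := by
  apply specBlock_eq_zero_of_forall
  intro j hj
  have hmem : φ j ∈ τ m' := by
    rw [← hj]
    exact hB.mem j
  unfold specTerm
  rw [h (φ j) hmem]
  simp only [periodT_zero, map_zero, mul_zero]

omit [IsTopologicalGroup G] in
/-- **the block of a rank-one pair**: if `R(f̄₁) = ⟪·, v⟫ w` and `R(f₂ˇ) = ⟪·, v'⟫ w'` on `τ m` (with `v, v' ∈ τ m`),
the `m`-block of the spectral expansion is `ℓ'(w') · conj ℓ(w) · ⟪v, v'⟫` (block Parseval). -/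
theorem specBlock_eq_of_rankOne {τ : ℕ → Set (G → ℂ)} (hB : S.IsAdaptedONB τ φ n) {m : ℕ} {v v' w w' : G → ℂ}
    (hv : v ∈ τ m) (hv' : v' ∈ τ m)
    (h₁ : ∀ ψ ∈ τ m, S.R (cj f₁) ψ = fun x => S.inner ψ v * w x)
    (h₂ : ∀ ψ ∈ τ m, S.R (refl f₂) ψ = fun x => S.inner ψ v' * w' x) :
    specBlock S χ χ' φ n f₁ f₂ m =
      S.periodT' χ' (fun t' => w' t') * starRingEnd ℂ (S.periodT χ (fun t => w t)) * S.inner v v' := by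
  set c : ℂ := S.periodT' χ' (fun t' => w' t') * starRingEnd ℂ (S.periodT χ (fun t => w t)) with hc
  have hterm : ∀ j : n ⁻¹' {m}, specTerm S χ χ' φ f₁ f₂ j = c * (S.inner v (φ j) * S.inner (φ j) v') := by
    intro j
    have hmem : φ j ∈ τ m := by
      have h := hB.mem (j : ℕ)
      rw [show n (j : ℕ) = m from j.2] at h
      exact h
    unfold specTerm
    rw [h₁ (φ j) hmem, h₂ (φ j) hmem]
    simp only []
    rw [S.periodT'_const_mul, S.periodT_const_mul, map_mul, S.conj_inner, hc]
    ring
  have hpar : HasSum (fun j : n ⁻¹' {m} => S.inner v (φ j) * S.inner (φ j) v') (S.inner v v') :=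
    S.hasSum_block_inner_mul_inner hB hv ((hB.inv m).cont v' hv')
  have hfun : (fun j : n ⁻¹' {m} => specTerm S χ χ' φ f₁ f₂ j) =
      fun j : n ⁻¹' {m} => c * (S.inner v (φ j) * S.inner (φ j) v') := funext hterm
  unfold specBlock
  rw [hfun]
  exact (hpar.mul_left c).tsum_eq

end Blocks

section RankOne

variable (τ : ℕ → Set (G → ℂ))

/-- **(C1)–(C3) IN RANK-ONE FORM, DISPLAYED — the Hecke block algebra of `τ m` on its admissible vectors**: for every
`v, w` in the displayed set `Vfin` of admissible vectors of `τ m` there is a test function `f` (an element of the Hecke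
algebra) whose right-regular action is ZERO on every other constituent `τ m'` and the RANK-ONE operator `ψ ↦ ⟪ψ, v⟫ w`
(for the `L²(D_G)` pairing `S.inner`) on `τ m`.  On the intended instance (`τ m` irreducible, admissible, pairwise
non-isomorphic) this is the consequence of the finiteness of the level set (A), the simplicity of the admissible
block over the Hecke algebra (C1), pairwise non-isomorphism (C2) and Jacobson density + Schur over ℂ (C3), for `Vfin`
= the `K_f`-fixed `K_∞`-finite vectors; it is FALSE for `Vfin = τ m`.  A HYPOTHESIS wherever it is used; proved
nowhere (paper note §1). -/
def HeckeRankOne (m : ℕ) (Vfin : Set (G → ℂ)) : Prop :=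
  ∀ v ∈ Vfin, ∀ w ∈ Vfin, ∃ f : G → ℂ, IsTest f ∧
    (∀ m', m' ≠ m → ∀ ψ ∈ τ m', S.R f ψ = fun _ => 0) ∧
    (∀ ψ ∈ τ m, S.R f ψ = fun x => S.inner ψ v * w x)

variable {S τ}

/-- **THE STEP (D) — an isolating test pair from the Hecke block algebra** (over EVERY `RTF.Setting G`): if the Hecke
algebra realises every rank-one operator on the admissible vectors `Vfin ⊆ τ m` and kills the other constituents
(`HeckeRankOne`), and both toric periods are non-zero on `Vfin`, then some test pair `(f₁, f₂)` isolates `τ m`: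
every other block of the spectral expansion of `J(f₁ ⋆ f₂)` vanishes and the `m`-block does not.  Proof: with `w`,
`w'` the admissible vectors carrying the periods, `f₁ := cj f` where `R(f) = ⟪·, w⟫ w` and `f₂ := refl f'` where
`R(f') = ⟪·, w⟫ w'`; the other blocks vanish termwise; the `m`-block is `ℓ'(w') · conj ℓ(w) · ⟪w, w⟫` (block Parseval),
non-zero since `⟪w, w⟫ ≠ 0` for a non-zero continuous invariant `w` (`inner_self_ne_zero_of_invariant`). -/
theorem exists_isolatedAt_of_heckeRankOne [Countable S.Gk] [MeasurableMul G] {χ : S.T → ℂ} {χ' : S.T' → ℂ}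
    {φ : ℕ → G → ℂ} {n : ℕ → ℕ} (hB : S.IsAdaptedONB τ φ n) {m : ℕ} {Vfin : Set (G → ℂ)} (hV : Vfin ⊆ τ m)
    (hRO : HeckeRankOne S τ m Vfin)
    (hT : ∃ w ∈ Vfin, S.periodT χ (fun t => w t) ≠ 0)
    (hT' : ∃ w' ∈ Vfin, S.periodT' χ' (fun t' => w' t') ≠ 0) :
    ∃ f₁ f₂ : G → ℂ, IsTest f₁ ∧ IsTest f₂ ∧ IsolatedAt S χ χ' φ n f₁ f₂ m := by
  obtain ⟨w, hwV, hw⟩ := hT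
  obtain ⟨w', hw'V, hw'⟩ := hT'
  obtain ⟨f, hf, hfkill, hfm⟩ := hRO w hwV w hwV
  obtain ⟨f', hf', hf'kill, hf'm⟩ := hRO w hwV w' hw'V
  refine ⟨cj f, refl f', hf.cj, hf'.refl, ?_, ?_⟩
  · intro m' hm'
    apply S.specBlock_eq_zero_of_R_eq_zero χ χ' φ n (cj f) (refl f') hB
    intro ψ hψ
    rw [cj_cj]
    exact hfkill m' hm' ψ hψ
  · have hwm : w ∈ τ m := hV hwV
    have hblock := S.specBlock_eq_of_rankOne χ χ' φ n (cj f) (refl f') hB hwm hwm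
      (fun ψ hψ => by rw [cj_cj]; exact hfm ψ hψ) (fun ψ hψ => by rw [refl_refl]; exact hf'm ψ hψ)
    rw [hblock]
    have hw0 : w ≠ 0 := by
      intro h0
      apply hw
      rw [h0]
      exact S.periodT_zero
    have hww : S.inner w w ≠ 0 :=
      S.inner_self_ne_zero_of_invariant ((hB.inv m).cont w hwm) ((hB.inv m).inv w hwm) hw0
    exact mul_ne_zero (mul_ne_zero hw' (by simpa using hw)) hww

end RankOne

end Setting

end RTF

section Interface

open NumberField Common PeriodCloser

variable {Form : Type} [AddCommGroup Form] [Module ℂ Form] {A : FormAlgebra Form} {W : Witness A}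
  {G : Type} [Group G] [TopologicalSpace G] [IsTopologicalGroup G] [MeasurableSpace G] [BorelSpace G]
  (S : RTF.Setting G) (χ : S.T → ℂ) (χ' : S.T' → ℂ) (τ : ℕ → Set (G → ℂ)) (Lift : ℕ → Prop)
  (φ : ℕ → G → ℂ) (n : ℕ → ℕ) (tf : W.Translates → (G → ℂ) × (G → ℂ))

/-- **the admissible-density clause for the `T`-period, DISPLAYED**: a toric period non-zero on `τ m` is non-zero on
the admissible vectors `Vfin m` of `τ m` (on the instance: the admissible vectors are dense in the smooth topology, in
which the toric periods are continuous — plan-1's archimedean refinement).  A HYPOTHESIS wherever it is used. -/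
def PeriodAdmissible (Vfin : ℕ → Set (G → ℂ)) : Prop :=
  ∀ m, S.PeriodNonzeroT χ (τ m) → ∃ w ∈ Vfin m, S.periodT χ (fun t => w t) ≠ 0

/-- **the admissible-density clause for the `T'`-period, DISPLAYED** (twin of `PeriodAdmissible`). -/
def PeriodAdmissible' (Vfin : ℕ → Set (G → ℂ)) : Prop :=
  ∀ m, S.PeriodNonzeroT' χ' (τ m) → ∃ w' ∈ Vfin m, S.periodT' χ' (fun t' => w' t') ≠ 0

/-- **(S3b) — the dictionary, DISPLAYED**: a test pair isolating `τ m` is the test pair of some Hecke choice of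
translates (the Hecke-choice test pairs `tf` are DATA of the residual, constructed nowhere).  A HYPOTHESIS wherever it
is used; proved nowhere. -/
def Realised : Prop :=
  ∀ (m : ℕ) (f₁ f₂ : G → ℂ), RTF.IsTest f₁ → RTF.IsTest f₂ → S.IsolatedAt χ χ' φ n f₁ f₂ m →
    ∃ γ' : W.Translates, S.IsolatedAt χ χ' φ n (tf γ').1 (tf γ').2 m

/-- **(S3″) from the Hecke block algebra**: `IsolationRealised` (p1's (S3″)) from `HeckeRankOne` at every `m`, the two
admissible-density clauses and the dictionary clause (S3b); the lift clause `Lift m` is not used — with the RTF half a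
theorem its weight sits in (S1″). -/
theorem isolationRealised_of_heckeRankOne [Countable S.Gk] [MeasurableMul G] (hB : S.IsAdaptedONB τ φ n)
    (Vfin : ℕ → Set (G → ℂ)) (hV : ∀ m, Vfin m ⊆ τ m) (hRO : ∀ m, RTF.Setting.HeckeRankOne S τ m (Vfin m))
    (hPA : PeriodAdmissible S χ τ Vfin) (hPA' : PeriodAdmissible' S χ' τ Vfin)
    (hreal : Realised S χ χ' φ n tf) : IsolationRealised S χ χ' τ Lift φ n tf := by
  intro m hT hT' _
  obtain ⟨f₁, f₂, h₁, h₂, hiso⟩ :=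
    RTF.Setting.exists_isolatedAt_of_heckeRankOne hB (hV m) (hRO m) (hPA m hT) (hPA' m hT')
  exact hreal m f₁ f₂ h₁ h₂ hiso

end Interface

end Summit.Ventures.HodgeRepro.Tier4.Line1

end
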